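import Literature.MathematicalPhysics.QuantumLattice.HubbardGridFieldSubstitution
import HarnessLib

/-!
# The grid propagators of a normal charged covariance: Gram form

Topic `MathematicalPhysics/QuantumLattice`; the grid analogue (`HubbardGridFieldSubstitution`: fields at an arbitrary finite set of
space–time points, substitution `gridSubMatrix`) of `HubbardSectorPropagatorGram` (sector fields).  For the pulled-back covariance
`C' = Sᵀ (normalCovariance p) S` of the grid fields the charge hypothesis of the single-scale step is
`gridSub_pullback_normalCovariance_apply_of_charge_eq`; this file supplies the GRAM hypothesis (Benfatto–Giuliani–Mastropietro 2006,
(2.80); 2003, (3.52)): explicit vectors `gridGramF X`, `gridGramG Y` in `ℓ²(FreqMomentum × spin)` with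

* `inner_gridGramF_gridGramG`, **`contr_gridSub_pullback_normalCovariance_eq_inner`** — `contr C' X Y = ⟪F_X, G_Y⟫` for `X` of charge `0`
  and `Y` of charge `1`;
* **`norm_sq_gridGramF`**, **`norm_sq_gridGramG`** — `‖F_X‖² = ‖G_Y‖² = (βL²)⁻² Σ_k ‖p(k, σ)‖`: the phase-space sum of the symbol.

Everything is proved; the two Gram vectors are the only definitions; no named facts.

## Sources

G. Benfatto, A. Giuliani, V. Mastropietro, Ann. Henri Poincaré 7 (2006) 809–898, §2.8 (2.80) [`BenfattoGiulianiMastropietro2006`];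
G. Benfatto, A. Giuliani, V. Mastropietro, Ann. Henri Poincaré 4 (2003) 137–193, §3 (3.52) [`BenfattoGiulianiMastropietro2003`].
-/

noncomputable section

namespace Literature.MathematicalPhysics.QuantumLattice

open Literature.Probability.LatticeModels GrassmannAlgebra Finset
open scoped InnerProductSpace ComplexConjugate

variable (L M : ℕ) [NeZero L] {P : Type*}

/-- The left Gram vector of the grid leg `X = ((a, σ), ·)` (charge `0`):
`F_X(k, s) = δ_{sσ} · (βL²)⁻¹ e^{-i k·x_a} · √‖p(k,σ)‖` (BGM 2006, (2.80)). [cite: BenfattoGiulianiMastropietro2006, §2.8 (2.80)] -/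
def gridGramF (β : ℝ) (x : P → TorusSite 2 L) (τ : P → ℝ) (p : FreqMomentum L M × Fin 2 → ℂ) (X : GridLeg P) :
    EuclideanSpace ℂ (FreqMomentum L M × Fin 2) :=
  WithLp.toLp 2 fun ks => if ks.2 = X.1.2 then
    conj (((1 / (β * (L : ℝ) ^ 2) : ℝ) : ℂ) * conj (vertexPlaneWave L M β 0 ks.1 (x X.1.1) (τ X.1.1))) *
      ((Real.sqrt ‖p ks‖ : ℝ) : ℂ) else 0

/-- The right Gram vector of the grid leg `Y = ((b, σ'), ·)` (charge `1`):
`G_Y(k, s) = -δ_{sσ'} · (βL²)⁻¹ conj(e^{+ik·x_b}) · √‖p(k,σ')‖ · p/‖p‖`. [cite: BenfattoGiulianiMastropietro2006, §2.8 (2.80)] -/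
def gridGramG (β : ℝ) (x : P → TorusSite 2 L) (τ : P → ℝ) (p : FreqMomentum L M × Fin 2 → ℂ) (Y : GridLeg P) :
    EuclideanSpace ℂ (FreqMomentum L M × Fin 2) :=
  WithLp.toLp 2 fun ks => if ks.2 = Y.1.2 then
    -((((1 / (β * (L : ℝ) ^ 2) : ℝ) : ℂ) * conj (vertexPlaneWave L M β 1 ks.1 (x Y.1.1) (τ Y.1.1))) *
      (((Real.sqrt ‖p ks‖ : ℝ) : ℂ) * p ks / (‖p ks‖ : ℂ))) else 0

variable {L M}

/-- **The inner product of the Gram vectors is minus the `(0,1)` grid propagator.** [cite: BenfattoGiulianiMastropietro2006, §2.8 (2.80)] -/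
theorem inner_gridGramF_gridGramG (β : ℝ) (x : P → TorusSite 2 L) (τ : P → ℝ) (p : FreqMomentum L M × Fin 2 → ℂ) (X Y : GridLeg P) :
    ⟪gridGramF L M β x τ p X, gridGramG L M β x τ p Y⟫_ℂ =
      if X.1.2 = Y.1.2 then
        -∑ k : FreqMomentum L M,
          (((1 / (β * (L : ℝ) ^ 2) : ℝ) : ℂ) * conj (vertexPlaneWave L M β 0 k (x X.1.1) (τ X.1.1))) * p (k, X.1.2) *
          (((1 / (β * (L : ℝ) ^ 2) : ℝ) : ℂ) * conj (vertexPlaneWave L M β 1 k (x Y.1.1) (τ Y.1.1)))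
        else 0 := by
  simp only [gridGramF, gridGramG, PiLp.inner_apply, RCLike.inner_apply]
  rw [Fintype.sum_prod_type_right]
  by_cases hσ : X.1.2 = Y.1.2
  · rw [if_pos hσ, sum_eq_single_of_mem X.1.2 (mem_univ _) fun s _ hs => sum_eq_zero fun k _ => by
      simp [hs], ← sum_neg_distrib]
    refine sum_congr rfl fun k _ => ?_
    dsimp only
    rw [if_pos rfl, if_pos hσ, map_mul, Complex.conj_conj, Complex.conj_ofReal]
    have key := sqrt_mul_sqrt_mul_div_norm (p (k, X.1.2))
    linear_combination (-((((1 / (β * (L : ℝ) ^ 2) : ℝ) : ℂ) * conj (vertexPlaneWave L M β 0 k (x X.1.1) (τ X.1.1))) *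
      (((1 / (β * (L : ℝ) ^ 2) : ℝ) : ℂ) * conj (vertexPlaneWave L M β 1 k (x Y.1.1) (τ Y.1.1))))) * key
  · rw [if_neg hσ]
    refine sum_eq_zero fun s _ => sum_eq_zero fun k _ => ?_
    dsimp only
    by_cases h1 : s = X.1.2
    · rw [if_neg (fun h2 => hσ (h1.symm.trans h2)), zero_mul]
    · rw [if_neg h1, map_zero, mul_zero]

/-- **The GRAM hypothesis for grid fields**: for a grid leg `X` of charge `0` and `Y` of charge `1`,
`contr (Sᵀ C S) X Y = ⟪F_X, G_Y⟫` (BGM 2006, (2.80)). [cite: BenfattoGiulianiMastropietro2006, §2.8 (2.80)] -/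
theorem contr_gridSub_pullback_normalCovariance_eq_inner [Fintype P] (β : ℝ) (x : P → TorusSite 2 L) (τ : P → ℝ)
    (p : FreqMomentum L M × Fin 2 → ℂ) {X Y : GridLeg P} (hX : X.2 = 0) (hY : Y.2 = 1) :
    contr ℂ ((gridSubMatrix L M β x τ).transpose * normalCovariance L M p * gridSubMatrix L M β x τ) X Y =
      ⟪gridGramF L M β x τ p X, gridGramG L M β x τ p Y⟫_ℂ := by
  set C' := (gridSubMatrix L M β x τ).transpose * normalCovariance L M p * gridSubMatrix L M β x τ with hC'
  have hanti : C' Y X = -C' X Y := by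
    have h := congrFun (congrFun (gridSub_pullback_normalCovariance_transpose β x τ p) X) Y
    rwa [Matrix.transpose_apply, Matrix.neg_apply] at h
  rw [contr_apply, hanti, show ((1 / 2 : ℚ) • (1 : ℂ)) * (-C' X Y - C' X Y) = -C' X Y by
    rw [Rat.smul_one_eq_cast]; push_cast; ring]
  obtain ⟨⟨a, σ⟩, c⟩ := X
  obtain ⟨⟨b, σ'⟩, c'⟩ := Y
  simp only at hX hY
  subst hX hY
  rw [hC', gridSub_pullback_apply, inner_gridGramF_gridGramG]
  simp only
  split_ifs with hσ
  · subst hσ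
    congr 1
    refine sum_congr rfl fun k _ => ?_
    rw [sum_eq_single_of_mem k (mem_univ _) fun k' _ hk' => by
      rw [normalCovariance_apply, if_neg (fun h => hk' (Prod.mk.inj h).1.symm), mul_zero, zero_mul]]
    rw [normalCovariance_apply, if_pos rfl]
    simp
  · rw [sum_eq_zero fun k _ => sum_eq_zero fun k' _ => ?_, neg_zero]
    rw [normalCovariance_apply, if_neg (fun h => hσ (Prod.mk.inj h).2), mul_zero, zero_mul]

/-- **The norm of the left Gram vector is the phase-space sum of the symbol**: `‖F_X‖² = Σ_k (βL²)⁻² ‖p(k,σ)‖`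
(plane waves are unimodular; BGM 2006, (2.80)). [cite: BenfattoGiulianiMastropietro2006, §2.8 (2.80)] -/
theorem norm_sq_gridGramF (β : ℝ) (x : P → TorusSite 2 L) (τ : P → ℝ) (p : FreqMomentum L M × Fin 2 → ℂ) (X : GridLeg P) :
    ‖gridGramF L M β x τ p X‖ ^ 2 = ∑ k : FreqMomentum L M, ‖((1 / (β * (L : ℝ) ^ 2) : ℝ) : ℂ)‖ ^ 2 * ‖p (k, X.1.2)‖ := by
  rw [EuclideanSpace.norm_eq, Real.sq_sqrt (sum_nonneg fun _ _ => by positivity), Fintype.sum_prod_type_right,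
    sum_eq_single_of_mem X.1.2 (mem_univ _) fun s _ hs => sum_eq_zero fun k _ => by simp [gridGramF, hs]]
  refine sum_congr rfl fun k _ => ?_
  simp only [gridGramF, WithLp.ofLp_toLp, if_true, norm_mul, Complex.norm_conj, norm_vertexPlaneWave, mul_one,
    Complex.norm_real, Real.norm_eq_abs, abs_of_nonneg (Real.sqrt_nonneg _)]
  rw [mul_pow, Real.sq_sqrt (norm_nonneg _)]

/-- **The norm of the right Gram vector is the same phase-space sum.** [cite: BenfattoGiulianiMastropietro2006, §2.8 (2.80)] -/
theorem norm_sq_gridGramG (β : ℝ) (x : P → TorusSite 2 L) (τ : P → ℝ) (p : FreqMomentum L M × Fin 2 → ℂ) (Y : GridLeg P) :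
    ‖gridGramG L M β x τ p Y‖ ^ 2 = ∑ k : FreqMomentum L M, ‖((1 / (β * (L : ℝ) ^ 2) : ℝ) : ℂ)‖ ^ 2 * ‖p (k, Y.1.2)‖ := by
  rw [EuclideanSpace.norm_eq, Real.sq_sqrt (sum_nonneg fun _ _ => by positivity), Fintype.sum_prod_type_right,
    sum_eq_single_of_mem Y.1.2 (mem_univ _) fun s _ hs => sum_eq_zero fun k _ => by simp [gridGramG, hs]]
  refine sum_congr rfl fun k _ => ?_
  simp only [gridGramG, WithLp.ofLp_toLp, if_true, norm_neg, norm_mul, norm_div, Complex.norm_conj,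
    norm_vertexPlaneWave, mul_one, Complex.norm_real, Real.norm_eq_abs, abs_of_nonneg (Real.sqrt_nonneg _),
    abs_of_nonneg (norm_nonneg _)]
  by_cases hp : p (k, Y.1.2) = 0
  · simp [hp]
  · have hn : 0 < ‖p (k, Y.1.2)‖ := norm_pos_iff.2 hp
    rw [mul_div_assoc, div_self hn.ne', mul_one, mul_pow, Real.sq_sqrt hn.le]

end Literature.MathematicalPhysics.QuantumLattice

end
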